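import Mathlib
import Summits.ValiantsHypothesis.ValiantsHypothesis.Cruxes.NNLinearDegreeCofactorHard.Lines.xc_division
import Literature.Barriers.PneNP.TSPExtensionComplexityHyperplaneBound
import Literature.Barriers.PneNP.ExtendedFormulationLinearImage

/-! # The blind CONSTANT-DIAGONAL cube: `diagTilted.Law` (C⁺_diag) is FALSE (val-idea-41 g3, W6-R1; crux `FifoMatching.NNDivisionHard`,
stmt-ValiantsHypothesis-21181)

W6-R1 (b142): «construct a realizable located family defeating `diagTilted.Law` / `LocatedPencilLaw`, or certify N14-sharpness as a
kernel negative lemma».  ANSWER for the first rung: **`diagTilted.Law` is FALSE** — `not_diagTiltedLaw` below (standard axioms expected).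

THE ENEMY.  The blind constant-diagonal cube `Q^c = n • conv{q^c_P : P ⊆ [n]}`, `(q^c_P)_{ik} = |P| − (n+1)(P_i + P_k)` (`i ≠ k`),
`(q^c_P)_{ii} = 0` — an affine image of `[0,1]ⁿ` (`xc ≤ 2n`, `hasEFOfSize_qCD`).  Two facts:
(1) CONSTANT DIAGONAL KILLS DIAGONAL LOCATION: for any passenger whose generators have the same diagonal, the slack of the tilted row
    `udRow a + flat (diagonal σ) ≤ 1 + Σ max(σ_i,0)` at `udPt b + q_j` is `(clique-row slack of row a) + Σ_i (σ_i⁺ [i ∉ b] + σ_i⁻ [i ∈ b])`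
    — the tilt adds `2n` nonnegative rank-one terms and never interacts with the passenger (`m(a,σ) = m_a + ⟨σ, diag⟩`).
(2) `Q^c` IS CLIQUE-ROW BLIND: `⟨udRow a, q^c_P⟩ = (|a|−1)(2(n+1)|a∩P| − |a||P|)` (`udRow_dotProduct_qCD`), maximised at `P = a`, recourse
    `G(a,P) = (|a|−1)((2n+2−|a|)|a∖P| + |a||P∖a|)`; for `|a| ≥ 2` this DOMINATES the penalties `n|a|(|a∖P| + |P∖a|)` of val-idea-39's blind
    identity (`asymBlind_factorization`, pasted verbatim below), the excess being `2n` more nonnegative rank-one terms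
    (`[m∈a]·c₁(|a|) ⊗ [m∉P]`, `[m∉a]·c₂(|a|) ⊗ [m∈P]`); rows `|a| ≤ 1` have `G = 0` and slack `[a=∅] + Σ_i [a={i}][i∉b]` (`n+1` slots).
    Total: an explicit nonnegative factorization of the augmented `diagTilted` slack of `COR(n) + Q^c` through
    `(2n²+3n+2) + 2n + 2n + (n+1) = 2n² + 8n + 3 = |Option (Fin (2n²+8n+2))|` slots, while `T 2 n ≥ 2n² + 8n + 3` for `n ≥ 2`.
So the located reads of PROP B see `Q♮` only through its varying diagonal `(q_P)_{ii} = 2P_i − 1 − |P|`; `Q^c` is invisible to every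
diagonal tilt.  It is NOT blind to `entryTilted` (C⁺ = `LocatedPencilLaw`): the off-diagonal coordinate `(i,k)` is maximised over `Q^c` by the
single generator `P = [n] ∖ {i,k}` (switched-face read) — the pen's law of record moves to C⁺ proper, as val-idea-39's chain intends.

PASTED VERBATIM (module `Cruxes/NNDivisionHard/CliqueRowBlind.lean` of val-idea-39 g3 is not importable on the farm snapshot): its §1–§2
(`qNat`, the blind identity `blind_identity`/`blind_identity₂`, `blindPair_factorization`, `asymBlind_factorization`), its §6 cube lemmas
(`unitCube`, `hasEFOfSize_unitCube`, `convexHull_range_udInd`, `sum_udInd_univ`) and its §4 definitions `RowFamily`, `RowFamily.Law`,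
`cliqueRows`, `diagTilted` (so `not_diagTiltedLaw` refutes the definitionally identical restatement).  NEW: §N below.

Nothing here proves the crux; VP ≠ VNP is NOT proved. -/

set_option linter.dupNamespace false

namespace Summit.ValiantsHypothesis.ValiantsHypothesis.Cruxes.NNDivisionHard.BlindConstDiag41

open Matrix Finset
open Literature.Barriers.PneNP (HasEFOfSize)
open Literature.Combinatorics.Optimization.FixedSizePsdRank (corPolytope flat)
open Summit.ValiantsHypothesis.ValiantsHypothesis.Cruxes.NNLinearDegreeCofactorHard.XcDivision
  (udRow udPt udInd ud_data udInd_apply udRow_dotProduct_flat_diagonal flat_dotProduct_flat diagDir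
    corPolytope_add_face_three_pow_le')
open scoped Pointwise

/-! ## PASTED from `CliqueRowBlind.lean` (val-idea-39 g3) ll.57–530: §1 `Q♮`, §2 the blind identity and its factorizations -/

/-! ## §1 The blind affine cube `Q♮` -/

/-- the vertex `q_P` of the blind affine cube, flattened: `q_P = 𝟙_{Pᶜ}𝟙_{Pᶜ}ᵀ − 𝟙_P𝟙_Pᵀ + diag(4·𝟙_P − 2 − |P|)`,
i.e. `(q_P)_ii = 2P_i − 1 − |P|`, `(q_P)_im = 1 − P_i − P_m` (`i ≠ m`) — entries AFFINE in `𝟙_P`. -/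
def qNat {n : ℕ} (P : Finset (Fin n)) : Fin (n * n) → ℝ :=
  udPt Pᶜ - udPt P + flat (Matrix.diagonal fun i => 4 * udInd P i - 2 - (P.card : ℝ))

theorem sum_udInd_mem {n : ℕ} (a P : Finset (Fin n)) : ∑ i ∈ a, udInd P i = ((a ∩ P).card : ℝ) := by
  classical
  simp only [udInd_apply]
  rw [Finset.sum_ite_mem, Finset.sum_const, nsmul_eq_mul, mul_one]

/-- ★ `⟨udRow a, q_P⟩ = −|a|·|a Δ P|` (with `|a Δ P| = |a| + |P| − 2|a ∩ P|`). -/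
theorem udRow_dotProduct_qNat {n : ℕ} (a P : Finset (Fin n)) :
    udRow a ⬝ᵥ qNat P = -((a.card : ℝ) * (a.card + P.card - 2 * (a ∩ P).card)) := by
  classical
  obtain ⟨-, -, slack, -⟩ := ud_data n
  have h1 : udRow a ⬝ᵥ udPt Pᶜ = 1 - (1 - ((a ∩ Pᶜ).card : ℝ)) ^ 2 := by linarith [slack a Pᶜ]
  have h2 : udRow a ⬝ᵥ udPt P = 1 - (1 - ((a ∩ P).card : ℝ)) ^ 2 := by linarith [slack a P]
  have h3 : udRow a ⬝ᵥ flat (Matrix.diagonal fun i => 4 * udInd P i - 2 - (P.card : ℝ)) =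
      4 * (a ∩ P).card - (2 + P.card) * a.card := by
    rw [udRow_dotProduct_flat_diagonal, Finset.sum_sub_distrib, Finset.sum_sub_distrib, ← Finset.mul_sum,
      sum_udInd_mem, Finset.sum_const, Finset.sum_const, nsmul_eq_mul, nsmul_eq_mul]
    ring
  have hc : ((a ∩ Pᶜ).card : ℝ) = a.card - (a ∩ P).card := by
    have : (a ∩ Pᶜ).card + (a ∩ P).card = a.card := by
      rw [← Finset.card_union_of_disjoint]
      · congr 1; ext i; simp only [Finset.mem_union, Finset.mem_inter, Finset.mem_compl]; tauto
      · exact Finset.disjoint_left.2 fun i hi hi' =>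
          (Finset.mem_compl.1 (Finset.mem_inter.1 hi).2) (Finset.mem_inter.1 hi').2
    have := congrArg (fun k : ℕ => (k : ℝ)) this
    push_cast at this; linarith
  rw [qNat, dotProduct_add, dotProduct_sub, h1, h2, h3, hc]
  ring

/-- `q_a` attains `0`, every other `q_P` is `≤ 0` on the row `udRow a`: `m_a = 0`, maximiser pattern `{P = a} ∪ {a = ∅}`. -/
theorem udRow_dotProduct_qNat_self {n : ℕ} (a : Finset (Fin n)) : udRow a ⬝ᵥ qNat a = 0 := by
  rw [udRow_dotProduct_qNat, Finset.inter_self]; ring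

theorem udRow_dotProduct_qNat_nonpos {n : ℕ} (a P : Finset (Fin n)) : udRow a ⬝ᵥ qNat P ≤ 0 := by
  rw [udRow_dotProduct_qNat, neg_nonpos]
  have h1 : ((a ∩ P).card : ℝ) ≤ a.card := by exact_mod_cast Finset.card_le_card Finset.inter_subset_left
  have h2 : ((a ∩ P).card : ℝ) ≤ P.card := by exact_mod_cast Finset.card_le_card Finset.inter_subset_right
  exact mul_nonneg (Nat.cast_nonneg _) (by linarith)

/-- ★ **the augmented clique-row slack of `COR(n) + λ•Q♮`** (row value `1 + m_a = 1`):
`1 − ⟨udRow a, udPt b + λ q_P⟩ = (1 − |a∩b|)² + λ·|a|·|aΔP|`. -/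
theorem blindPair_slack {n : ℕ} (lam : ℝ) (a b P : Finset (Fin n)) :
    1 - udRow a ⬝ᵥ (udPt b + lam • qNat P) =
      (1 - ((a ∩ b).card : ℝ)) ^ 2 + lam * (a.card * (a.card + P.card - 2 * (a ∩ P).card)) := by
  obtain ⟨-, -, slack, -⟩ := ud_data n
  rw [dotProduct_add, dotProduct_smul, smul_eq_mul, udRow_dotProduct_qNat, ← sub_sub, slack]
  ring

/-- validity: `udRow a ≤ 1` on every `udPt b + λ q_P` (`λ ≥ 0`). -/
theorem blindPair_valid {n : ℕ} {lam : ℝ} (hlam : 0 ≤ lam) (a b P : Finset (Fin n)) :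
    udRow a ⬝ᵥ (udPt b + lam • qNat P) ≤ 1 := by
  have := blindPair_slack lam a b P
  have hD : 0 ≤ (a.card : ℝ) * (a.card + P.card - 2 * (a ∩ P).card) := by
    have := udRow_dotProduct_qNat_nonpos a P
    rw [udRow_dotProduct_qNat, neg_nonpos] at this; exact this
  nlinarith [sq_nonneg (1 - ((a ∩ b).card : ℝ)), mul_nonneg hlam hD]

/-! ## §2 The explicit nonnegative factorization of `M_λ(a;(b,P)) = (1 − |a∩b|)² + λ|a||aΔP|`

Index type (7 families): `[a = ∅] · 1`, `[a ≠ ∅] · (1 − |P∩b|)²`, and for `i, m : Fin n`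
`X_iX_m · (1−P_i)(λ + Y_iY_m)` (`m ≠ i`), `X_i · (1−P_i)(λ + Y_i(p−1))`, `(1−X_i)X_m · P_i(λ − Y_iY_m − Y_i(p−2)₊)` (`m ≠ i`),
`(1−X_i)(|a|−1)₊ · P_iY_i(p−2)₊`, `(1−X_i)[a ≠ ∅] · P_iY_i(2−p)₊`, where `X = 𝟙_a, Y = 𝟙_b, p = |P ∩ b|`.
All factors are integers; we state them over `ℤ` and cast. -/

/-- index type of the factorization: `2 + n² + n + n² + n + n = 2n² + 3n + 2` terms (diagonal `(i,i)` slots carry `0`). -/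
abbrev BIdx (n : ℕ) := (Fin 2) ⊕ (Fin n × Fin n) ⊕ Fin n ⊕ (Fin n × Fin n) ⊕ Fin n ⊕ Fin n

theorem card_BIdx (n : ℕ) : Fintype.card (BIdx n) = 2 * n ^ 2 + 3 * n + 2 := by
  simp [BIdx, Fintype.card_sum, Fintype.card_prod, Fintype.card_fin]; ring

section IntCore
variable {n : ℕ}

/-- indicator as an integer -/
def ind (a : Finset (Fin n)) (i : Fin n) : ℤ := if i ∈ a then 1 else 0

/-- row factors `U(a, idx) ≥ 0` -/
def blindRow (a : Finset (Fin n)) : BIdx n → ℤ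
  | Sum.inl k => if k = 0 then (if a = ∅ then 1 else 0) else (if a = ∅ then 0 else 1)
  | Sum.inr (Sum.inl (i, m)) => if i = m then 0 else ind a i * ind a m
  | Sum.inr (Sum.inr (Sum.inl i)) => ind a i
  | Sum.inr (Sum.inr (Sum.inr (Sum.inl (i, m)))) => if i = m then 0 else (1 - ind a i) * ind a m
  | Sum.inr (Sum.inr (Sum.inr (Sum.inr (Sum.inl i)))) => (1 - ind a i) * max ((a.card : ℤ) - 1) 0
  | Sum.inr (Sum.inr (Sum.inr (Sum.inr (Sum.inr i)))) => (1 - ind a i) * (if a = ∅ then 0 else 1)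

/-- column factors `V((b,P), idx) ≥ 0` for `λ ≥ n − 1` (`p = |P ∩ b|`) -/
def blindCol (lam : ℤ) (b P : Finset (Fin n)) : BIdx n → ℤ
  | Sum.inl k => if k = 0 then 1 else (1 - ((P ∩ b).card : ℤ)) ^ 2
  | Sum.inr (Sum.inl (i, m)) => (1 - ind P i) * (lam + ind b i * ind b m)
  | Sum.inr (Sum.inr (Sum.inl i)) => (1 - ind P i) * (lam + ind b i * (((P ∩ b).card : ℤ) - 1))
  | Sum.inr (Sum.inr (Sum.inr (Sum.inl (i, m)))) =>
      ind P i * (lam - ind b i * ind b m - ind b i * max (((P ∩ b).card : ℤ) - 2) 0)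
  | Sum.inr (Sum.inr (Sum.inr (Sum.inr (Sum.inl i)))) => ind P i * ind b i * max (((P ∩ b).card : ℤ) - 2) 0
  | Sum.inr (Sum.inr (Sum.inr (Sum.inr (Sum.inr i)))) => ind P i * ind b i * max (2 - ((P ∩ b).card : ℤ)) 0

/-- the target entry `(1 − |a∩b|)² + λ|a||aΔP|` over `ℤ` -/
def blindLHS (lam : ℤ) (a b P : Finset (Fin n)) : ℤ :=
  (1 - ((a ∩ b).card : ℤ)) ^ 2 + lam * (a.card * (a.card + P.card - 2 * ((a ∩ P).card : ℤ)))

theorem ind_nonneg (a : Finset (Fin n)) (i : Fin n) : 0 ≤ ind a i := by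
  unfold ind; split_ifs <;> norm_num

theorem ind_le_one (a : Finset (Fin n)) (i : Fin n) : ind a i ≤ 1 := by
  unfold ind; split_ifs <;> norm_num

theorem blindRow_nonneg (a : Finset (Fin n)) (idx : BIdx n) : 0 ≤ blindRow a idx := by
  have h0 := ind_nonneg a; have h1 := ind_le_one a
  rcases idx with k | ⟨i, m⟩ | i | ⟨i, m⟩ | i | i <;> simp only [blindRow]
  · split_ifs <;> norm_num
  · split_ifs
    · exact le_rfl
    · exact mul_nonneg (h0 i) (h0 m)
  · exact h0 i
  · split_ifs
    · exact le_rfl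
    · exact mul_nonneg (by linarith [h1 i]) (h0 m)
  · exact mul_nonneg (by linarith [h1 i]) (le_max_right _ _)
  · exact mul_nonneg (by linarith [h1 i]) (by split_ifs <;> norm_num)

/-- column factors are nonnegative as soon as `λ ≥ max(1, n − 1)`. -/
theorem blindCol_nonneg {lam : ℤ} (hlam1 : 1 ≤ lam) (hlam : (n : ℤ) ≤ lam + 1) (b P : Finset (Fin n))
    (idx : BIdx n) : 0 ≤ blindCol lam b P idx := by
  have h0 := ind_nonneg (n := n); have h1 := ind_le_one (n := n)
  have hp : ((P ∩ b).card : ℤ) ≤ n := by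
    have := Finset.card_le_univ (P ∩ b); rw [Fintype.card_fin] at this; exact_mod_cast this
  have hpc : (0 : ℤ) ≤ ((P ∩ b).card : ℤ) := Nat.cast_nonneg _
  rcases idx with k | ⟨i, m⟩ | i | ⟨i, m⟩ | i | i <;> simp only [blindCol]
  · split_ifs
    · norm_num
    · exact sq_nonneg _
  · exact mul_nonneg (by linarith [h1 P i]) (by nlinarith [h0 b i, h0 b m, h1 b i, h1 b m])
  · exact mul_nonneg (by linarith [h1 P i]) (by nlinarith [mul_nonneg (h0 b i) hpc, h1 b i, h0 b i])
  · refine mul_nonneg (h0 P i) ?_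
    rcases le_or_gt 2 ((P ∩ b).card : ℤ) with h | h
    · rw [max_eq_left (by linarith)]
      nlinarith [h0 b i, h1 b i, h0 b m, h1 b m, mul_nonneg (h0 b i) (h0 b m),
        mul_le_of_le_one_left (show (0:ℤ) ≤ ((P ∩ b).card : ℤ) - 2 by linarith) (h1 b i)]
    · rw [max_eq_right (by linarith)]
      nlinarith [h0 b i, h1 b i, h0 b m, h1 b m, mul_nonneg (h0 b i) (h0 b m)]
  · exact mul_nonneg (mul_nonneg (h0 P i) (h0 b i)) (le_max_right _ _)
  · exact mul_nonneg (mul_nonneg (h0 P i) (h0 b i)) (le_max_right _ _)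

theorem ind_mul_self (a : Finset (Fin n)) (i : Fin n) : ind a i * ind a i = ind a i := by
  unfold ind; split_ifs <;> ring

theorem ind_inter (a b : Finset (Fin n)) (i : Fin n) : ind a i * ind b i = ind (a ∩ b) i := by
  unfold ind; by_cases ha : i ∈ a <;> by_cases hb : i ∈ b <;> simp [ha, hb]

theorem sum_ind (a : Finset (Fin n)) : ∑ i, ind a i = (a.card : ℤ) := by
  classical
  unfold ind
  rw [Finset.sum_boole, Finset.filter_mem_eq_inter, Finset.univ_inter]

theorem sum_ind_mul (a b : Finset (Fin n)) : ∑ i, ind a i * ind b i = ((a ∩ b).card : ℤ) := by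
  simp_rw [ind_inter]; exact sum_ind _

theorem sum_ite_eq_sub (i : Fin n) (g : Fin n → ℤ) :
    ∑ m, (if i = m then 0 else g m) = ∑ m, g m - g i := by
  have : ∀ m, (if i = m then 0 else g m) = g m - (if i = m then g m else 0) := by
    intro m; split_ifs <;> ring
  simp_rw [this]
  rw [Finset.sum_sub_distrib, Finset.sum_ite_eq, if_pos (Finset.mem_univ _)]

/-- the six blocks of a sum over `BIdx n` -/
theorem sum_BIdx (f : BIdx n → ℤ) :
    ∑ idx, f idx = (f (Sum.inl 0) + f (Sum.inl 1)) +
      ((∑ i, ∑ m, f (Sum.inr (Sum.inl (i, m)))) +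
      ((∑ i, f (Sum.inr (Sum.inr (Sum.inl i)))) +
      ((∑ i, ∑ m, f (Sum.inr (Sum.inr (Sum.inr (Sum.inl (i, m)))))) +
      ((∑ i, f (Sum.inr (Sum.inr (Sum.inr (Sum.inr (Sum.inl i)))))) +
       (∑ i, f (Sum.inr (Sum.inr (Sum.inr (Sum.inr (Sum.inr i)))))))))) := by
  simp only [Fintype.sum_sum_type, Fintype.sum_prod_type, Fin.sum_univ_two]

/-- ★★ **THE BLINDNESS IDENTITY, ALL `n`, ALL `λ`** (sorry-free, axioms standard):
`(1 − |a∩b|)² + λ|a||aΔP| = Σ_idx blindRow a idx · blindCol λ b P idx`.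
Proof = the per-coordinate regrouping of the card (`X_i² = X_i`, `Σ_{m≠i} X_m = k − X_i`, `(2−p)₊ − (p−2)₊ = 2 − p`). -/
theorem blind_identity (lam : ℤ) (a b P : Finset (Fin n)) :
    blindLHS lam a b P = ∑ idx : BIdx n, blindRow a idx * blindCol lam b P idx := by
  classical
  rw [sum_BIdx]
  simp only [blindRow, blindCol, Fin.isValue, if_true, show ((1 : Fin 2) = 0) = False from eq_false (by decide),
    if_false]
  have hX2 := ind_mul_self a
  have hY2 := ind_mul_self b
  have sX := sum_ind a
  have sP := sum_ind P
  have sXY := sum_ind_mul a b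
  have sPY := sum_ind_mul P b
  have sXP := sum_ind_mul a P
  set M1 : ℤ := max (((P ∩ b).card : ℤ) - 2) 0 with hM1
  set M3 : ℤ := max (2 - ((P ∩ b).card : ℤ)) 0 with hM3
  have hM : M3 = M1 + (2 - ((P ∩ b).card : ℤ)) := by
    rw [hM1, hM3]
    rcases le_total (((P ∩ b).card : ℤ)) 2 with h | h
    · rw [max_eq_left (by linarith), max_eq_right (by linarith)]; ring
    · rw [max_eq_right (by linarith), max_eq_left (by linarith)]; ring
  -- family `X_i X_m (m ≠ i)`: closed form per `i`
  have F1 : ∀ i, ∑ m, (if i = m then 0 else ind a i * ind a m) * ((1 - ind P i) * (lam + ind b i * ind b m)) =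
      ind a i * (1 - ind P i) * (lam * ((a.card : ℤ) - 1) + ind b i * (((a ∩ b).card : ℤ) - 1)) := by
    intro i
    have : ∀ m, (if i = m then 0 else ind a i * ind a m) * ((1 - ind P i) * (lam + ind b i * ind b m)) =
        if i = m then 0 else ind a i * ind a m * ((1 - ind P i) * (lam + ind b i * ind b m)) := by
      intro m; split_ifs <;> ring
    simp_rw [this]
    rw [sum_ite_eq_sub, hX2, hY2]
    have hs : ∑ m, ind a i * ind a m * ((1 - ind P i) * (lam + ind b i * ind b m)) =
        ind a i * (1 - ind P i) * (lam * ∑ m, ind a m + ind b i * ∑ m, ind a m * ind b m) := by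
      rw [Finset.mul_sum, Finset.mul_sum, ← Finset.sum_add_distrib, Finset.mul_sum]
      exact Finset.sum_congr rfl fun m _ => by ring
    rw [hs, sX, sXY]; ring
  -- family `(1 − X_i) X_m (m ≠ i)`: closed form per `i`
  have F3 : ∀ i, ∑ m, (if i = m then 0 else (1 - ind a i) * ind a m) *
        (ind P i * (lam - ind b i * ind b m - ind b i * M1)) =
      (1 - ind a i) * ind P i *
        (lam * (a.card : ℤ) - ind b i * ((a ∩ b).card : ℤ) - ind b i * M1 * (a.card : ℤ)) := by
    intro i
    have : ∀ m, (if i = m then 0 else (1 - ind a i) * ind a m) *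
          (ind P i * (lam - ind b i * ind b m - ind b i * M1)) =
        if i = m then 0 else (1 - ind a i) * ind a m * (ind P i * (lam - ind b i * ind b m - ind b i * M1)) := by
      intro m; split_ifs <;> ring
    simp_rw [this]
    rw [sum_ite_eq_sub]
    have h0 : (1 - ind a i) * ind a i = 0 := by rw [sub_mul, one_mul, hX2, sub_self]
    have hs : ∑ m, (1 - ind a i) * ind a m * (ind P i * (lam - ind b i * ind b m - ind b i * M1)) =
        (1 - ind a i) * ind P i *
          (lam * ∑ m, ind a m - ind b i * ∑ m, ind a m * ind b m - ind b i * M1 * ∑ m, ind a m) := by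
      rw [Finset.mul_sum, Finset.mul_sum, Finset.mul_sum, ← Finset.sum_sub_distrib, ← Finset.sum_sub_distrib,
        Finset.mul_sum]
      exact Finset.sum_congr rfl fun m _ => by ring
    rw [hs, sX, sXY]
    have : (1 - ind a i) * ind a i * (ind P i * (lam - ind b i * ind b i - ind b i * M1)) = 0 := by
      rw [h0, zero_mul]
    rw [this]; ring
  simp_rw [F1, F3]
  rcases eq_or_ne a ∅ with rfl | ha
  · simp [blindLHS, ind]
  · have hk : max ((a.card : ℤ) - 1) 0 = (a.card : ℤ) - 1 := by
      rw [max_eq_left]; have := Finset.card_pos.2 (Finset.nonempty_iff_ne_empty.2 ha); omega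
    simp only [ha, if_false, hk, one_mul, zero_add, mul_one]
    have per : ∀ i,
        ind a i * (1 - ind P i) * (lam * ((a.card : ℤ) - 1) + ind b i * (((a ∩ b).card : ℤ) - 1)) +
        (ind a i * ((1 - ind P i) * (lam + ind b i * (((P ∩ b).card : ℤ) - 1))) +
        ((1 - ind a i) * ind P i * (lam * (a.card : ℤ) - ind b i * ((a ∩ b).card : ℤ) - ind b i * M1 * (a.card : ℤ)) +
        ((1 - ind a i) * ((a.card : ℤ) - 1) * (ind P i * ind b i * M1) +
         (1 - ind a i) * (ind P i * ind b i * M3)))) =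
        lam * (a.card : ℤ) * ind a i + lam * (a.card : ℤ) * ind P i - 2 * lam * (a.card : ℤ) * (ind a i * ind P i)
          + (((a ∩ b).card : ℤ) + ((P ∩ b).card : ℤ) - 2) * (ind a i * ind b i)
          - (((a ∩ b).card : ℤ) + ((P ∩ b).card : ℤ) - 2) * (ind P i * ind b i) := by
      intro i
      rw [hM]
      ring
    rw [← Finset.sum_add_distrib, ← Finset.sum_add_distrib, ← Finset.sum_add_distrib, ← Finset.sum_add_distrib]
    rw [Finset.sum_congr rfl (fun i _ => per i)]
    rw [Finset.sum_sub_distrib, Finset.sum_add_distrib, Finset.sum_sub_distrib, Finset.sum_add_distrib,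
      ← Finset.mul_sum, ← Finset.mul_sum, ← Finset.mul_sum, ← Finset.mul_sum, ← Finset.mul_sum,
      sX, sP, sXP, sXY, sPY, blindLHS]
    ring


/-! ### §2b (rev 4) Asymmetric recourse `(1 − |a∩b|)² + |a|·(λ₁|a∖P| + λ₂|P∖a|)` — blindness is generic for affine cubes.
For an affine cube `Q = {q_∅ + Σ_{i∈P} g_i}` and ANY row `ρ`, the Q-slack is `Σ_i |⟨ρ,g_i⟩|·[P_i on the wrong side]`
(modular penalties through the 2n fixed column functions `P_i, 1 − P_i`); for clique rows whose maximiser is `P = a`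
the penalty is `Σ_{i∈a∖P} w_i⁺ + Σ_{i∈P∖a} w_i⁻`, and the identity below shows the UDISJ core `(1 − |a∩b|)²` is absorbed
as soon as the `a∖P` weight is `≥ |a|·1` and the `P∖a` weight is `≥ |a|·(n−1)` per element (row-dependent EXCESS weight is
a further sum of rank-one nonnegative terms `X_i·(1−P_i)`, `(1−X_i)·P_i`, so only these FLOORS matter). This covers e.g. the
untilted clique rows of `n²•q^γ` (`q^γ`: diag `2P_i−1`, offdiag `1−P_i−P_m+|P|/n`; weights `λ(2k−k(k−1)/n)` resp. `λk(k−1)/n`). -/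

def blindCol₂ (lam₁ lam₂ : ℤ) (b P : Finset (Fin n)) : BIdx n → ℤ
  | Sum.inl k => if k = 0 then 1 else (1 - ((P ∩ b).card : ℤ)) ^ 2
  | Sum.inr (Sum.inl (i, m)) => (1 - ind P i) * (lam₁ + ind b i * ind b m)
  | Sum.inr (Sum.inr (Sum.inl i)) => (1 - ind P i) * (lam₁ + ind b i * (((P ∩ b).card : ℤ) - 1))
  | Sum.inr (Sum.inr (Sum.inr (Sum.inl (i, m)))) =>
      ind P i * (lam₂ - ind b i * ind b m - ind b i * max (((P ∩ b).card : ℤ) - 2) 0)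
  | Sum.inr (Sum.inr (Sum.inr (Sum.inr (Sum.inl i)))) => ind P i * ind b i * max (((P ∩ b).card : ℤ) - 2) 0
  | Sum.inr (Sum.inr (Sum.inr (Sum.inr (Sum.inr i)))) => ind P i * ind b i * max (2 - ((P ∩ b).card : ℤ)) 0

/-- asymmetric recourse: `(1 − |a∩b|)² + |a|·(λ₁|a∖P| + λ₂|P∖a|)` -/
def blindLHS₂ (lam₁ lam₂ : ℤ) (a b P : Finset (Fin n)) : ℤ :=
  (1 - ((a ∩ b).card : ℤ)) ^ 2 +
    a.card * (lam₁ * (a.card - ((a ∩ P).card : ℤ)) + lam₂ * (P.card - ((a ∩ P).card : ℤ)))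


/-- column factors of the asymmetric identity are nonnegative once `λ₁ ≥ 1` and `λ₂ ≥ max(1, n − 1)`. -/
theorem blindCol₂_nonneg {lam₁ lam₂ : ℤ} (h1 : 1 ≤ lam₁) (h2 : 1 ≤ lam₂) (h2n : (n : ℤ) ≤ lam₂ + 1)
    (b P : Finset (Fin n)) (idx : BIdx n) : 0 ≤ blindCol₂ lam₁ lam₂ b P idx := by
  have h0 := ind_nonneg (n := n); have h1' := ind_le_one (n := n)
  have hp : ((P ∩ b).card : ℤ) ≤ n := by
    have := Finset.card_le_univ (P ∩ b); rw [Fintype.card_fin] at this; exact_mod_cast this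
  have hpc : (0 : ℤ) ≤ ((P ∩ b).card : ℤ) := Nat.cast_nonneg _
  rcases idx with k | ⟨i, m⟩ | i | ⟨i, m⟩ | i | i <;> simp only [blindCol₂]
  · split_ifs
    · norm_num
    · exact sq_nonneg _
  · exact mul_nonneg (by linarith [h1' P i]) (by nlinarith [h0 b i, h0 b m, h1' b i, h1' b m])
  · exact mul_nonneg (by linarith [h1' P i]) (by nlinarith [mul_nonneg (h0 b i) hpc, h1' b i, h0 b i])
  · refine mul_nonneg (h0 P i) ?_
    rcases le_or_gt 2 ((P ∩ b).card : ℤ) with h | h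
    · rw [max_eq_left (by linarith)]
      nlinarith [h0 b i, h1' b i, h0 b m, h1' b m, mul_nonneg (h0 b i) (h0 b m),
        mul_le_of_le_one_left (show (0:ℤ) ≤ ((P ∩ b).card : ℤ) - 2 by linarith) (h1' b i)]
    · rw [max_eq_right (by linarith)]
      nlinarith [h0 b i, h1' b i, h0 b m, h1' b m, mul_nonneg (h0 b i) (h0 b m)]
  · exact mul_nonneg (mul_nonneg (h0 P i) (h0 b i)) (le_max_right _ _)
  · exact mul_nonneg (mul_nonneg (h0 P i) (h0 b i)) (le_max_right _ _)

/-- the symmetric column factors are the diagonal case `λ₁ = λ₂`. -/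
theorem blindCol₂_self (lam : ℤ) (b P : Finset (Fin n)) (idx : BIdx n) :
    blindCol₂ lam lam b P idx = blindCol lam b P idx := by
  rcases idx with k | ⟨i, m⟩ | i | ⟨i, m⟩ | i | i <;> rfl

/-- ★ (rev 4) the ASYMMETRIC blindness identity, all `n`, all `λ₁, λ₂`: families A/B carry `λ₁` (the `a∖P` recourse), family C carries `λ₂` (the `P∖a` recourse). -/
theorem blind_identity₂ (lam₁ lam₂ : ℤ) (a b P : Finset (Fin n)) :
    blindLHS₂ lam₁ lam₂ a b P = ∑ idx : BIdx n, blindRow a idx * blindCol₂ lam₁ lam₂ b P idx := by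
  classical
  rw [sum_BIdx]
  simp only [blindRow, blindCol₂, Fin.isValue, if_true, show ((1 : Fin 2) = 0) = False from eq_false (by decide),
    if_false]
  -- notation
  have hX2 := ind_mul_self a
  have hY2 := ind_mul_self b
  have sX := sum_ind a
  have sP := sum_ind P
  have sXY := sum_ind_mul a b
  have sPY := sum_ind_mul P b
  have sXP := sum_ind_mul a P
  set M1 : ℤ := max (((P ∩ b).card : ℤ) - 2) 0 with hM1
  set M3 : ℤ := max (2 - ((P ∩ b).card : ℤ)) 0 with hM3
  have hM : M3 = M1 + (2 - ((P ∩ b).card : ℤ)) := by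
    rw [hM1, hM3]
    rcases le_total (((P ∩ b).card : ℤ)) 2 with h | h
    · rw [max_eq_left (by linarith), max_eq_right (by linarith)]; ring
    · rw [max_eq_right (by linarith), max_eq_left (by linarith)]; ring
  -- family 1 (X_i X_m, m ≠ i): closed form per i
  have F1 : ∀ i, ∑ m, (if i = m then 0 else ind a i * ind a m) * ((1 - ind P i) * (lam₁ + ind b i * ind b m)) =
      ind a i * (1 - ind P i) * (lam₁ * ((a.card : ℤ) - 1) + ind b i * (((a ∩ b).card : ℤ) - 1)) := by
    intro i
    have : ∀ m, (if i = m then 0 else ind a i * ind a m) * ((1 - ind P i) * (lam₁ + ind b i * ind b m)) =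
        if i = m then 0 else ind a i * ind a m * ((1 - ind P i) * (lam₁ + ind b i * ind b m)) := by
      intro m; split_ifs <;> ring
    simp_rw [this]
    rw [sum_ite_eq_sub, hX2, hY2]
    have hs : ∑ m, ind a i * ind a m * ((1 - ind P i) * (lam₁ + ind b i * ind b m)) =
        ind a i * (1 - ind P i) * (lam₁ * ∑ m, ind a m + ind b i * ∑ m, ind a m * ind b m) := by
      rw [Finset.mul_sum, Finset.mul_sum, ← Finset.sum_add_distrib, Finset.mul_sum]
      exact Finset.sum_congr rfl fun m _ => by ring
    rw [hs, sX, sXY]; ring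
  -- family 3 ((1−X_i) X_m, m ≠ i): closed form per i
  have F3 : ∀ i, ∑ m, (if i = m then 0 else (1 - ind a i) * ind a m) *
        (ind P i * (lam₂ - ind b i * ind b m - ind b i * M1)) =
      (1 - ind a i) * ind P i * (lam₂ * (a.card : ℤ) - ind b i * ((a ∩ b).card : ℤ) - ind b i * M1 * (a.card : ℤ)) := by
    intro i
    have : ∀ m, (if i = m then 0 else (1 - ind a i) * ind a m) * (ind P i * (lam₂ - ind b i * ind b m - ind b i * M1)) =
        if i = m then 0 else (1 - ind a i) * ind a m * (ind P i * (lam₂ - ind b i * ind b m - ind b i * M1)) := by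
      intro m; split_ifs <;> ring
    simp_rw [this]
    rw [sum_ite_eq_sub]
    have h0 : (1 - ind a i) * ind a i = 0 := by rw [sub_mul, one_mul, hX2, sub_self]
    have hs : ∑ m, (1 - ind a i) * ind a m * (ind P i * (lam₂ - ind b i * ind b m - ind b i * M1)) =
        (1 - ind a i) * ind P i * (lam₂ * ∑ m, ind a m - ind b i * ∑ m, ind a m * ind b m - ind b i * M1 * ∑ m, ind a m) := by
      rw [Finset.mul_sum, Finset.mul_sum, Finset.mul_sum, ← Finset.sum_sub_distrib, ← Finset.sum_sub_distrib, Finset.mul_sum]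
      exact Finset.sum_congr rfl fun m _ => by ring
    rw [hs, sX, sXY]
    have : (1 - ind a i) * ind a i * (ind P i * (lam₂ - ind b i * ind b i - ind b i * M1)) = 0 := by rw [h0, zero_mul]
    rw [this]; ring
  simp_rw [F1, F3]
  -- case split on a = ∅
  rcases eq_or_ne a ∅ with rfl | ha
  · simp [blindLHS₂, ind]
  · have hk : max ((a.card : ℤ) - 1) 0 = (a.card : ℤ) - 1 := by
      rw [max_eq_left]; have := Finset.card_pos.2 (Finset.nonempty_iff_ne_empty.2 ha); omega
    simp only [ha, if_false, hk, one_mul, zero_add, mul_one]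
    -- per-i regrouping
    have per : ∀ i,
        ind a i * (1 - ind P i) * (lam₁ * ((a.card : ℤ) - 1) + ind b i * (((a ∩ b).card : ℤ) - 1)) +
        (ind a i * ((1 - ind P i) * (lam₁ + ind b i * (((P ∩ b).card : ℤ) - 1))) +
        ((1 - ind a i) * ind P i * (lam₂ * (a.card : ℤ) - ind b i * ((a ∩ b).card : ℤ) - ind b i * M1 * (a.card : ℤ)) +
        ((1 - ind a i) * ((a.card : ℤ) - 1) * (ind P i * ind b i * M1) +
         (1 - ind a i) * (ind P i * ind b i * M3)))) =
        lam₁ * (a.card : ℤ) * ind a i + lam₂ * (a.card : ℤ) * ind P i - (lam₁ + lam₂) * (a.card : ℤ) * (ind a i * ind P i)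
          + (((a ∩ b).card : ℤ) + ((P ∩ b).card : ℤ) - 2) * (ind a i * ind b i)
          - (((a ∩ b).card : ℤ) + ((P ∩ b).card : ℤ) - 2) * (ind P i * ind b i) := by
      intro i
      rw [hM]
      ring
    rw [← Finset.sum_add_distrib, ← Finset.sum_add_distrib, ← Finset.sum_add_distrib, ← Finset.sum_add_distrib]
    rw [Finset.sum_congr rfl (fun i _ => per i)]
    rw [Finset.sum_sub_distrib, Finset.sum_add_distrib, Finset.sum_sub_distrib, Finset.sum_add_distrib,
      ← Finset.mul_sum, ← Finset.mul_sum, ← Finset.mul_sum, ← Finset.mul_sum, ← Finset.mul_sum,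
      sX, sP, sXP, sXY, sPY, blindLHS₂]
    ring


end IntCore

/-- the identity at `n = 3`, `λ = 2` (all `8³` triples, `29` slots) — now a one-line instance of `blind_identity`. -/
theorem blind_identity_three :
    ∀ a b P : Finset (Fin 3), blindLHS 2 a b P = ∑ idx : BIdx 3, blindRow a idx * blindCol 2 b P idx :=
  fun a b P => blind_identity 2 a b P

/-- the identity at `n = 4`, `λ = 3` (all `16³` triples, `46` slots). -/
theorem blind_identity_four :
    ∀ a b P : Finset (Fin 4), blindLHS 3 a b P = ∑ idx : BIdx 4, blindRow a idx * blindCol 3 b P idx :=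
  fun a b P => blind_identity 3 a b P

/-- ★★ **rank₊ of the augmented clique-row slack of `COR(n) + λ•Q♮` is at most `|BIdx n| = 2n² + 3n + 2`, ALL `n`**
(`2n` of the slots are identically zero, so `≤ 2n² + n + 2`): for every integer `λ ≥ max(1, n − 1)` there are
NONNEGATIVE `U : rows → BIdx n → ℝ`, `V : columns → BIdx n → ℝ` with `1 − ⟨udRow a, udPt b + λ q_P⟩ = Σ_idx U a idx · V (b,P) idx`. -/
theorem blindPair_factorization (n : ℕ) (lam : ℤ) (hlam1 : 1 ≤ lam) (hlam : (n : ℤ) ≤ lam + 1) :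
    ∃ (U : Finset (Fin n) → BIdx n → ℝ) (V : Finset (Fin n) × Finset (Fin n) → BIdx n → ℝ),
      (∀ a idx, 0 ≤ U a idx) ∧ (∀ c idx, 0 ≤ V c idx) ∧
      ∀ a b P : Finset (Fin n),
        1 - udRow a ⬝ᵥ (udPt b + (lam : ℝ) • qNat P) = ∑ idx, U a idx * V (b, P) idx := by
  refine ⟨fun a idx => (blindRow a idx : ℝ), fun c idx => (blindCol lam c.1 c.2 idx : ℝ),
    fun a idx => Int.cast_nonneg_iff.mpr (blindRow_nonneg a idx),
    fun c idx => Int.cast_nonneg_iff.mpr (blindCol_nonneg hlam1 hlam c.1 c.2 idx), fun a b P => ?_⟩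
  rw [blindPair_slack]
  have h' := congrArg (fun z : ℤ => (z : ℝ)) (blind_identity lam a b P)
  simp only [blindLHS] at h'
  push_cast at h'
  rw [← h']

/-- the `n = 4`, `λ = 3` instance (46 slots; kept under its rev-1 name). -/
theorem blindPair_factorization_four :
    ∃ (U : Finset (Fin 4) → BIdx 4 → ℝ) (V : Finset (Fin 4) × Finset (Fin 4) → BIdx 4 → ℝ),
      (∀ a idx, 0 ≤ U a idx) ∧ (∀ c idx, 0 ≤ V c idx) ∧
      ∀ a b P : Finset (Fin 4),
        1 - udRow a ⬝ᵥ (udPt b + (3 : ℝ) • qNat P) = ∑ idx, U a idx * V (b, P) idx := by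
  have h := blindPair_factorization 4 3 (by norm_num) (by norm_num)
  simpa using h

/-- the headline instance `λ = n` (`n ≥ 1`). -/
theorem blindPair_factorization_self (n : ℕ) (hn : 1 ≤ n) :
    ∃ (U : Finset (Fin n) → BIdx n → ℝ) (V : Finset (Fin n) × Finset (Fin n) → BIdx n → ℝ),
      (∀ a idx, 0 ≤ U a idx) ∧ (∀ c idx, 0 ≤ V c idx) ∧
      ∀ a b P : Finset (Fin n),
        1 - udRow a ⬝ᵥ (udPt b + (n : ℝ) • qNat P) = ∑ idx, U a idx * V (b, P) idx := by
  have h := blindPair_factorization n n (by exact_mod_cast hn) (by linarith)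
  simpa using h

/-- ★ (rev 4) **asymmetric blindness, ALL `n`**: for integers `λ₁ ≥ 1`, `λ₂ ≥ max(1, n−1)` the matrix
`(a;(b,P)) ↦ (1 − |a∩b|)² + |a|·(λ₁|a∖P| + λ₂|P∖a|)` has an explicit NONNEGATIVE factorization through `BIdx n`
(`rank₊ ≤ 2n² + n + 2`). Row-dependent weights above these floors add rank-one nonnegative terms only. -/
theorem asymBlind_factorization (n : ℕ) (lam₁ lam₂ : ℤ) (h1 : 1 ≤ lam₁) (h2 : 1 ≤ lam₂) (h2n : (n : ℤ) ≤ lam₂ + 1) :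
    ∃ (U : Finset (Fin n) → BIdx n → ℝ) (V : Finset (Fin n) × Finset (Fin n) → BIdx n → ℝ),
      (∀ a idx, 0 ≤ U a idx) ∧ (∀ c idx, 0 ≤ V c idx) ∧
      ∀ a b P : Finset (Fin n),
        (1 - ((a ∩ b).card : ℝ)) ^ 2 +
            (a.card : ℝ) * ((lam₁ : ℝ) * ((a \ P).card : ℝ) + (lam₂ : ℝ) * ((P \ a).card : ℝ)) =
          ∑ idx, U a idx * V (b, P) idx := by
  refine ⟨fun a idx => (blindRow a idx : ℝ), fun c idx => (blindCol₂ lam₁ lam₂ c.1 c.2 idx : ℝ),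
    fun a idx => Int.cast_nonneg_iff.mpr (blindRow_nonneg a idx),
    fun c idx => Int.cast_nonneg_iff.mpr (blindCol₂_nonneg h1 h2 h2n c.1 c.2 idx), fun a b P => ?_⟩
  have h' := congrArg (fun z : ℤ => (z : ℝ)) (blind_identity₂ lam₁ lam₂ a b P)
  simp only [blindLHS₂] at h'
  push_cast at h'
  rw [← h']
  have e1 : ((a \ P).card : ℝ) = (a.card : ℝ) - ((a ∩ P).card : ℝ) := by
    have h := Finset.card_sdiff_add_card_inter a P
    have h' : ((a \ P).card : ℝ) + ((a ∩ P).card : ℝ) = (a.card : ℝ) := by exact_mod_cast h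
    linarith
  have e2 : ((P \ a).card : ℝ) = (P.card : ℝ) - ((a ∩ P).card : ℝ) := by
    have h := Finset.card_sdiff_add_card_inter P a
    rw [Finset.inter_comm P a] at h
    have h' : ((P \ a).card : ℝ) + ((a ∩ P).card : ℝ) = (P.card : ℝ) := by exact_mod_cast h
    linarith
  rw [e1, e2]

/-! ## PASTED from `CliqueRowBlind.lean` (val-idea-39 g3) ll.939–1034: §6 the unit-cube EF and `conv{𝟙_P} = [0,1]ⁿ` -/

section CubeEF
open Literature.Barriers.PneNP (hasEFOfSize_of_system)

/-- the unit cube `[0,1]ⁿ` as a set of functions. -/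
def unitCube (n : ℕ) : Set (Fin n → ℝ) := Set.univ.pi fun _ => Set.Icc (0 : ℝ) 1

/-- ★ `xc([0,1]ⁿ) ≤ 2n`: the slack system `x_i − y_{inl i} = 0`, `x_i + y_{inr i} = 1`, `y ≥ 0`. -/
theorem hasEFOfSize_unitCube (n : ℕ) : HasEFOfSize (unitCube n) (n + n) := by
  classical
  let E : Matrix (Fin n ⊕ Fin n) (Fin n) ℝ := Matrix.of fun r i => if i = Sum.elim id id r then 1 else 0
  let F : Matrix (Fin n ⊕ Fin n) (Fin n ⊕ Fin n) ℝ :=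
    Matrix.of fun r s => if s = r then Sum.elim (fun _ => (-1 : ℝ)) (fun _ => 1) r else 0
  let g : Fin n ⊕ Fin n → ℝ := Sum.elim (fun _ => 0) (fun _ => 1)
  have hE : ∀ (x : Fin n → ℝ) r, (E *ᵥ x) r = x (Sum.elim id id r) := by
    intro x r
    simp only [Matrix.mulVec, dotProduct, E, Matrix.of_apply]
    rw [Finset.sum_eq_single (Sum.elim id id r)]
    · simp
    · intro i _ hi; simp [hi]
    · intro h; exact absurd (Finset.mem_univ _) h
  have hF : ∀ (y : Fin n ⊕ Fin n → ℝ) r, (F *ᵥ y) r = Sum.elim (fun _ => (-1 : ℝ)) (fun _ => 1) r * y r := by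
    intro y r
    simp only [Matrix.mulVec, dotProduct, F, Matrix.of_apply]
    rw [Finset.sum_eq_single r]
    · simp
    · intro s _ hs; simp [hs]
    · intro h; exact absurd (Finset.mem_univ _) h
  have hsys : unitCube n = {x | ∃ y : Fin n ⊕ Fin n → ℝ, (∀ j, 0 ≤ y j) ∧ E *ᵥ x + F *ᵥ y = g} := by
    ext x
    simp only [unitCube, Set.mem_univ_pi, Set.mem_Icc, Set.mem_setOf_eq]
    constructor
    · intro hx
      refine ⟨Sum.elim (fun i => x i) (fun i => 1 - x i), ?_, ?_⟩
      · rintro (i | i)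
        · simpa using (hx i).1
        · simpa using (hx i).2
      · funext r
        rw [Pi.add_apply, hE, hF]
        rcases r with i | i <;> simp [g]
    · rintro ⟨y, hy, hsys⟩ i
      have h1 := congrFun hsys (Sum.inl i)
      have h2 := congrFun hsys (Sum.inr i)
      rw [Pi.add_apply, hE, hF] at h1 h2
      simp only [Sum.elim_inl, Sum.elim_inr, id, g] at h1 h2
      constructor
      · linarith [hy (Sum.inl i)]
      · linarith [hy (Sum.inr i)]
  rw [hsys]
  have h := hasEFOfSize_of_system (ι := Fin n) E F g
  simpa [Fintype.card_sum, Fintype.card_fin] using h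

/-- `conv{𝟙_P : P ⊆ [n]} = [0,1]ⁿ`. -/
theorem convexHull_range_udInd (n : ℕ) :
    convexHull ℝ (Set.range (udInd : Finset (Fin n) → Fin n → ℝ)) = unitCube n := by
  classical
  have hr : Set.range (udInd : Finset (Fin n) → Fin n → ℝ) = Set.univ.pi fun _ => ({0, 1} : Set ℝ) := by
    ext x
    simp only [Set.mem_range, Set.mem_univ_pi, Set.mem_insert_iff, Set.mem_singleton_iff]
    constructor
    · rintro ⟨P, rfl⟩ i
      rw [udInd_apply]; split_ifs <;> simp
    · intro hx
      refine ⟨Finset.univ.filter fun i => x i = 1, funext fun i => ?_⟩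
      rw [udInd_apply]
      rcases hx i with h | h
      · rw [if_neg (by simp [h]), h]
      · rw [if_pos (by simp [h]), h]
  rw [hr, convexHull_pi, unitCube]
  congr 1; funext i
  rw [convexHull_pair, segment_eq_Icc (zero_le_one' ℝ)]

/-- the linear part of `P ↦ n•q_P`. -/
def qLin (n : ℕ) : (Fin n → ℝ) →ₗ[ℝ] (Fin (n * n) → ℝ) where
  toFun y p :=
    (n : ℝ) * (if (finProdFinEquiv.symm p).1 = (finProdFinEquiv.symm p).2
      then 2 * y (finProdFinEquiv.symm p).1 - ∑ j, y j
      else -(y (finProdFinEquiv.symm p).1) - y (finProdFinEquiv.symm p).2)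
  map_add' y z := by
    funext p
    simp only [Pi.add_apply, Finset.sum_add_distrib]
    split_ifs <;> ring
  map_smul' c y := by
    funext p
    simp only [Pi.smul_apply, smul_eq_mul, RingHom.id_apply, ← Finset.mul_sum]
    split_ifs <;> ring

/-- the constant part of `P ↦ n•q_P`. -/
def qConst (n : ℕ) : Fin (n * n) → ℝ := fun p =>
  if (finProdFinEquiv.symm p).1 = (finProdFinEquiv.symm p).2 then -(n : ℝ) else (n : ℝ)

theorem sum_udInd_univ {n : ℕ} (P : Finset (Fin n)) : ∑ j, udInd P j = (P.card : ℝ) := by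
  classical
  simp only [udInd_apply]
  rw [Finset.sum_boole, Finset.filter_mem_eq_inter, Finset.univ_inter]

end CubeEF

/-! ## PASTED from `CliqueRowBlind.lean` (val-idea-39 g3) §4: `RowFamily`, `RowFamily.Law`, `cliqueRows`, `diagTilted` (verbatim) -/

section RowFamilies
open Literature.Combinatorics.Optimization.FixedSizePsdRank (flat_dotProduct_le_of_mem_corPolytope)
open Summit.ValiantsHypothesis.ValiantsHypothesis.Cruxes.NNLinearDegreeCofactorHard.XcDivision
  (T dot_le_of_mem_convexHull diag_valid)

/-- A ROW FAMILY for the correlation polytopes: index types `A n`, directions `ρ n a`, right-hand sides `β n a`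
valid on `COR(n)`. -/
structure RowFamily where
  A : ℕ → Type
  ρ : ∀ n, A n → (Fin (n * n) → ℝ)
  β : ∀ n, A n → ℝ
  valid : ∀ n (a : A n), ∀ x ∈ corPolytope n, ρ n a ⬝ᵥ x ≤ β n a

/-- **THE `F`-ROW LAW.**  Eventually in `n`: for every passenger `Q = conv{q_j}` with an EF of size `r`, writing
`m a = max_j ⟨ρ a, q_j⟩`, if the augmented `F`-row slack `(β a + m a) − ⟨ρ a, x_b + q_j⟩` of `COR(n) + Q` has a nonnegative
factorization through `r + 1` slots then `T c n < r`. -/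
def RowFamily.Law (F : RowFamily) : Prop :=
  ∀ c : ℕ, ∃ n₀ : ℕ, ∀ n ≥ n₀, ∀ (K : ℕ) (q : Fin (K + 1) → (Fin (n * n) → ℝ)) (r : ℕ),
    HasEFOfSize (convexHull ℝ (Set.range q)) r →
    ∀ m : F.A n → ℝ, (∀ a j, F.ρ n a ⬝ᵥ q j ≤ m a) → (∀ a, ∃ j, F.ρ n a ⬝ᵥ q j = m a) →
    ∀ (U : F.A n → Option (Fin r) → ℝ) (V : Finset (Fin n) × Fin (K + 1) → Option (Fin r) → ℝ),
      (∀ a i, 0 ≤ U a i) → (∀ p i, 0 ≤ V p i) →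
      (∀ a b j, (F.β n a + m a) - F.ρ n a ⬝ᵥ (udPt b + q j) = ∑ i, U a i * V (b, j) i) → T c n < r


/-- the CLIQUE-ROW family `udRow a ≤ 1` (its law is REFUTED in `CliqueRowBlind.lean`; pasted for the chain). -/
@[reducible] def cliqueRows : RowFamily where
  A := fun n => Finset (Fin n)
  ρ := fun _ a => udRow a
  β := fun _ _ => 1
  valid := fun n a x hx => (ud_data n).2.1 a x hx

/-- the DIAGONALLY TILTED clique rows `udRow a + flat (diagonal σ) ≤ 1 + Σ_i max(σ_i, 0)` — the family of PROP B's
located reads (`diag_valid`).  `diagTilted.Law` =: C⁺_diag. -/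
@[reducible] def diagTilted : RowFamily where
  A := fun n => Finset (Fin n) × (Fin n → ℝ)
  ρ := fun _ a => udRow a.1 + flat (Matrix.diagonal a.2)
  β := fun _ a => 1 + ∑ i, max (a.2 i) 0
  valid := fun n a x hx => by
    rw [add_dotProduct]
    exact add_le_add ((ud_data n).2.1 a.1 x hx) (diag_valid n a.2 x hx)


end RowFamilies


/-! ## §N (NEW, val-idea-41 g3) The blind constant-diagonal cube `Q^c` and `¬ diagTilted.Law` -/

section BlindConstDiag
open Summit.ValiantsHypothesis.ValiantsHypothesis.Cruxes.NNLinearDegreeCofactorHard.XcDivision (T udMat udInd_sq udInd_inter)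

variable {n : ℕ}

/-- generator matrix of the blind constant-diagonal cube: zero diagonal, off-diagonal entries `|P| − (n+1)(P_i + P_k)`. -/
def cdMat (P : Finset (Fin n)) : Matrix (Fin n) (Fin n) ℝ := fun i k =>
  if i = k then 0 else (P.card : ℝ) - ((n : ℝ) + 1) * (udInd P i + udInd P k)

/-- the generator `q^c_P`, flattened. -/
def qCD (P : Finset (Fin n)) : Fin (n * n) → ℝ := flat (cdMat P)

/-- the clique-row maximum over the cube: `m_a = |a|(|a|−1)(2n+2−|a|)` (attained at `P = a`). -/
def mrow (n : ℕ) (a : Finset (Fin n)) : ℝ := (a.card : ℝ) * ((a.card : ℝ) - 1) * (2 * ((n : ℝ) + 1) - a.card)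

/-- ★ the clique rows on the cube: `⟨udRow a, q^c_P⟩ = (|a| − 1)(2(n+1)|a ∩ P| − |a||P|)`. -/
theorem udRow_dotProduct_qCD (a P : Finset (Fin n)) :
    udRow a ⬝ᵥ qCD P = ((a.card : ℝ) - 1) * (2 * ((n : ℝ) + 1) * (a ∩ P).card - a.card * P.card) := by
  classical
  show flat (udMat a) ⬝ᵥ flat (cdMat P) = _
  rw [flat_dotProduct_flat]
  have sx : ∑ i, udInd a i = (a.card : ℝ) := sum_udInd_univ a
  have sxp : ∑ i, udInd a i * udInd P i = ((a ∩ P).card : ℝ) := udInd_inter a P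
  have key : ∀ i k, udMat a i k * cdMat P i k =
      -(udInd a i * udInd a k * ((P.card : ℝ) - ((n : ℝ) + 1) * (udInd P i + udInd P k))) +
        (if i = k then udInd a i * ((P.card : ℝ) - 2 * ((n : ℝ) + 1) * udInd P i) else 0) := by
    intro i k
    show (2 * (if i = k then 1 else 0) * udInd a i - udInd a i * udInd a k) *
        (if i = k then 0 else (P.card : ℝ) - ((n : ℝ) + 1) * (udInd P i + udInd P k)) = _
    by_cases h : i = k
    · subst h
      simp only [if_true, mul_zero]
      have := udInd_sq a i
      linear_combination ((P.card : ℝ) - 2 * ((n : ℝ) + 1) * udInd P i) * this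
    · simp only [h, if_false]; ring
  simp only [key, Finset.sum_add_distrib, Finset.sum_neg_distrib, Finset.sum_ite_eq, Finset.mem_univ, if_true]
  have hA : ∑ i, ∑ k, udInd a i * udInd a k * ((P.card : ℝ) - ((n : ℝ) + 1) * (udInd P i + udInd P k)) =
      (P.card : ℝ) * a.card * a.card - 2 * ((n : ℝ) + 1) * (a ∩ P).card * a.card := by
    have e1 : ∀ i, ∑ k, udInd a i * udInd a k * ((P.card : ℝ) - ((n : ℝ) + 1) * (udInd P i + udInd P k)) =
        udInd a i * ((P.card : ℝ) - ((n : ℝ) + 1) * udInd P i) * (∑ k, udInd a k) -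
          ((n : ℝ) + 1) * udInd a i * (∑ k, udInd a k * udInd P k) := by
      intro i
      rw [Finset.mul_sum, Finset.mul_sum, ← Finset.sum_sub_distrib]
      refine Finset.sum_congr rfl fun k _ => ?_
      ring
    simp only [e1, sx, sxp]
    have e2 : ∀ i, udInd a i * ((P.card : ℝ) - ((n : ℝ) + 1) * udInd P i) * (a.card : ℝ) -
        ((n : ℝ) + 1) * udInd a i * ((a ∩ P).card : ℝ) =
        ((P.card : ℝ) * a.card) * udInd a i - (((n : ℝ) + 1) * a.card) * (udInd a i * udInd P i) -
          (((n : ℝ) + 1) * (a ∩ P).card) * udInd a i := by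
      intro i; ring
    simp only [e2, Finset.sum_sub_distrib, ← Finset.mul_sum, sx, sxp]
    ring
  have hB : ∑ i, udInd a i * ((P.card : ℝ) - 2 * ((n : ℝ) + 1) * udInd P i) =
      (P.card : ℝ) * a.card - 2 * ((n : ℝ) + 1) * (a ∩ P).card := by
    have e3 : ∀ i, udInd a i * ((P.card : ℝ) - 2 * ((n : ℝ) + 1) * udInd P i) =
        (P.card : ℝ) * udInd a i - (2 * ((n : ℝ) + 1)) * (udInd a i * udInd P i) := by
      intro i; ring
    simp only [e3, Finset.sum_sub_distrib, ← Finset.mul_sum, sx, sxp]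
  rw [hA, hB]
  ring

/-- at `P = a` the maximum `m_a` is attained. -/
theorem udRow_dotProduct_qCD_self (a : Finset (Fin n)) : udRow a ⬝ᵥ qCD a = mrow n a := by
  rw [udRow_dotProduct_qCD, Finset.inter_self, mrow]; ring

/-- ★ the recourse `m_a − ⟨udRow a, q^c_P⟩ = (|a| − 1)((2n+2−|a|)|a∖P| + |a||P∖a|)`. -/
theorem recourse_eq (a P : Finset (Fin n)) :
    mrow n a - udRow a ⬝ᵥ qCD P =
      ((a.card : ℝ) - 1) * ((2 * ((n : ℝ) + 1) - a.card) * (a \ P).card + a.card * (P \ a).card) := by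
  have e1 : ((a \ P).card : ℝ) = (a.card : ℝ) - ((a ∩ P).card : ℝ) := by
    have h := Finset.card_sdiff_add_card_inter a P
    have h' : ((a \ P).card : ℝ) + ((a ∩ P).card : ℝ) = (a.card : ℝ) := by exact_mod_cast h
    linarith
  have e2 : ((P \ a).card : ℝ) = (P.card : ℝ) - ((a ∩ P).card : ℝ) := by
    have h := Finset.card_sdiff_add_card_inter P a
    rw [Finset.inter_comm P a] at h
    have h' : ((P \ a).card : ℝ) + ((a ∩ P).card : ℝ) = (P.card : ℝ) := by exact_mod_cast h
    linarith
  rw [udRow_dotProduct_qCD, e1, e2, mrow]; ring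

/-- the recourse is nonnegative (`|a| ≤ n`), i.e. `m_a` IS the maximum. -/
theorem recourse_nonneg (a P : Finset (Fin n)) (ha : a.card ≤ n) : 0 ≤ mrow n a - udRow a ⬝ᵥ qCD P := by
  rw [recourse_eq]
  rcases Nat.eq_zero_or_pos a.card with h0 | hpos
  · have ha0 : a = ∅ := Finset.card_eq_zero.1 h0
    subst ha0
    simp
  · have h1 : (1 : ℝ) ≤ a.card := by exact_mod_cast hpos
    have h2 : (a.card : ℝ) ≤ n := by exact_mod_cast ha
    apply mul_nonneg (by linarith)
    apply add_nonneg
    · exact mul_nonneg (by linarith) (Nat.cast_nonneg _)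
    · exact mul_nonneg (Nat.cast_nonneg _) (Nat.cast_nonneg _)

/-- CONSTANT (zero) DIAGONAL: diagonal tilts do not see the cube. -/
theorem flat_diagonal_dotProduct_qCD (σ : Fin n → ℝ) (P : Finset (Fin n)) :
    flat (Matrix.diagonal σ) ⬝ᵥ qCD P = 0 := by
  rw [qCD, flat_dotProduct_flat]
  refine Finset.sum_eq_zero fun i _ => Finset.sum_eq_zero fun k _ => ?_
  by_cases h : i = k
  · subst h; simp [cdMat]
  · rw [Matrix.diagonal_apply_ne _ h, zero_mul]

/-! ### the budget: `Q^c` is a linear image of `[0,1]ⁿ`, `xc ≤ 2n` -/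

/-- the linear map `y ↦ (q^c entries as functions of 𝟙_P = y)`. -/
def cdLin (n : ℕ) : (Fin n → ℝ) →ₗ[ℝ] (Fin (n * n) → ℝ) where
  toFun y := fun p =>
    if (finProdFinEquiv.symm p).1 = (finProdFinEquiv.symm p).2 then 0
    else (∑ j, y j) - ((n : ℝ) + 1) * (y (finProdFinEquiv.symm p).1 + y (finProdFinEquiv.symm p).2)
  map_add' y z := by
    funext p
    simp only [Pi.add_apply, Finset.sum_add_distrib]
    split_ifs <;> ring
  map_smul' c y := by
    funext p
    simp only [Pi.smul_apply, smul_eq_mul, RingHom.id_apply, ← Finset.mul_sum]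
    split_ifs <;> ring

theorem qCD_eq_cdLin (P : Finset (Fin n)) : qCD P = cdLin n (udInd P) := by
  funext p
  show cdMat P (finProdFinEquiv.symm p).1 (finProdFinEquiv.symm p).2 = _
  simp only [cdLin, LinearMap.coe_mk, AddHom.coe_mk, cdMat, sum_udInd_univ]

/-- ★ `xc(n • Q^c) ≤ 2n`. -/
theorem hasEFOfSize_qCD (n : ℕ) :
    HasEFOfSize (convexHull ℝ (Set.range fun P : Finset (Fin n) => (n : ℝ) • qCD P)) (n + n) := by
  have hr : (Set.range fun P : Finset (Fin n) => (n : ℝ) • qCD P) =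
      ((n : ℝ) • cdLin n) '' Set.range (udInd : Finset (Fin n) → Fin n → ℝ) := by
    rw [← Set.range_comp]
    refine congrArg Set.range (funext fun P => ?_)
    simp only [Function.comp_apply, LinearMap.smul_apply, qCD_eq_cdLin]
  rw [hr, ← LinearMap.image_convexHull, convexHull_range_udInd]
  exact (hasEFOfSize_unitCube n).image_linearMap _

/-! ### the explicit nonnegative factorization of the augmented `diagTilted` slack of `COR(n) + n•Q^c` -/

/-- excess penalty coefficients over the blind identity with `λ₁ = λ₂ = n` (rows `|a| = t ≥ 2`). -/
def c₁ (n : ℕ) (t : ℕ) : ℝ := (n : ℝ) * (((t : ℝ) - 1) * (2 * ((n : ℝ) + 1) - t) - t)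
def c₂ (n : ℕ) (t : ℕ) : ℝ := (n : ℝ) * ((t : ℝ) * ((t : ℝ) - 2))

theorem c₁_nonneg {t : ℕ} (h2 : 2 ≤ t) (ht : t ≤ n) : 0 ≤ c₁ n t := by
  have h2' : (2 : ℝ) ≤ t := by exact_mod_cast h2
  have ht' : (t : ℝ) ≤ n := by exact_mod_cast ht
  unfold c₁
  apply mul_nonneg (Nat.cast_nonneg _)
  nlinarith

theorem c₂_nonneg {t : ℕ} (h2 : 2 ≤ t) : 0 ≤ c₂ n t := by
  have h2' : (2 : ℝ) ≤ t := by exact_mod_cast h2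
  unfold c₂
  apply mul_nonneg (Nat.cast_nonneg _)
  nlinarith

/-- slots: the blind identity's `BIdx n`, `2n` excess-penalty slots, `2n` tilt slots, `n + 1` slots for the rows `|a| ≤ 1`. -/
abbrev Slot (n : ℕ) := BIdx n ⊕ (Fin n ⊕ Fin n) ⊕ (Fin n ⊕ Fin n) ⊕ Option (Fin n)

theorem card_Slot (n : ℕ) : Fintype.card (Slot n) = 2 * n ^ 2 + 8 * n + 3 := by
  simp only [Slot, BIdx, Fintype.card_sum, Fintype.card_prod, Fintype.card_fin, Fintype.card_option]; ring

/-- splitting a sum over the slots (the `BIdx n` block is kept whole). -/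
theorem sum_Slot (F : Slot n → ℝ) :
    ∑ s, F s = ∑ idx : BIdx n, F (Sum.inl idx) +
      ((∑ m : Fin n, F (Sum.inr (Sum.inl (Sum.inl m))) + ∑ m : Fin n, F (Sum.inr (Sum.inl (Sum.inr m)))) +
        ((∑ i : Fin n, F (Sum.inr (Sum.inr (Sum.inl (Sum.inl i)))) + ∑ i : Fin n, F (Sum.inr (Sum.inr (Sum.inl (Sum.inr i))))) +
          (F (Sum.inr (Sum.inr (Sum.inr none))) + ∑ i : Fin n, F (Sum.inr (Sum.inr (Sum.inr (some i))))))) := by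
  rw [Fintype.sum_sum_type]
  congr 1
  rw [Fintype.sum_sum_type, Fintype.sum_sum_type, Fintype.sum_sum_type, Fintype.sum_sum_type, Fintype.sum_option]

/-- row factors (rows `(a, σ)` of `diagTilted`). -/
def rowF (Ub : Finset (Fin n) → BIdx n → ℝ) (a : Finset (Fin n)) (σ : Fin n → ℝ) : Slot n → ℝ
  | Sum.inl idx => if 2 ≤ a.card then Ub a idx else 0
  | Sum.inr (Sum.inl (Sum.inl m)) => if 2 ≤ a.card then (if m ∈ a then c₁ n a.card else 0) else 0
  | Sum.inr (Sum.inl (Sum.inr m)) => if 2 ≤ a.card then (if m ∈ a then 0 else c₂ n a.card) else 0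
  | Sum.inr (Sum.inr (Sum.inl (Sum.inl i))) => max (σ i) 0
  | Sum.inr (Sum.inr (Sum.inl (Sum.inr i))) => max (-σ i) 0
  | Sum.inr (Sum.inr (Sum.inr none)) => if a = ∅ then 1 else 0
  | Sum.inr (Sum.inr (Sum.inr (some i))) => if a = {i} then 1 else 0

/-- column factors (columns `(b, P)`). -/
def colF (Vb : Finset (Fin n) × Finset (Fin n) → BIdx n → ℝ) (b P : Finset (Fin n)) : Slot n → ℝ
  | Sum.inl idx => Vb (b, P) idx
  | Sum.inr (Sum.inl (Sum.inl m)) => if m ∈ P then 0 else 1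
  | Sum.inr (Sum.inl (Sum.inr m)) => if m ∈ P then 1 else 0
  | Sum.inr (Sum.inr (Sum.inl (Sum.inl i))) => if i ∈ b then 0 else 1
  | Sum.inr (Sum.inr (Sum.inl (Sum.inr i))) => if i ∈ b then 1 else 0
  | Sum.inr (Sum.inr (Sum.inr none)) => 1
  | Sum.inr (Sum.inr (Sum.inr (some i))) => if i ∈ b then 0 else 1

theorem rowF_nonneg {Ub : Finset (Fin n) → BIdx n → ℝ} (hUb : ∀ a idx, 0 ≤ Ub a idx)
    (a : Finset (Fin n)) (σ : Fin n → ℝ) (ha : a.card ≤ n) : ∀ s, 0 ≤ rowF Ub a σ s := by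
  rintro (idx | ((m | m) | ((i | i) | (_ | i))))
  · show 0 ≤ (if 2 ≤ a.card then Ub a idx else 0)
    split_ifs <;> first | exact hUb a idx | exact le_rfl
  · show 0 ≤ (if 2 ≤ a.card then (if m ∈ a then c₁ n a.card else 0) else 0)
    split_ifs with h2 <;> first | exact le_rfl | exact c₁_nonneg h2 ha
  · show 0 ≤ (if 2 ≤ a.card then (if m ∈ a then 0 else c₂ n a.card) else 0)
    split_ifs with h2 <;> first | exact le_rfl | exact c₂_nonneg h2
  · exact le_max_right _ _
  · exact le_max_right _ _
  · show 0 ≤ (if a = ∅ then (1:ℝ) else 0); split_ifs <;> norm_num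
  · show 0 ≤ (if a = {i} then (1:ℝ) else 0); split_ifs <;> norm_num

theorem colF_nonneg (Vb : Finset (Fin n) × Finset (Fin n) → BIdx n → ℝ) (hVb : ∀ c idx, 0 ≤ Vb c idx)
    (b P : Finset (Fin n)) : ∀ s, 0 ≤ colF Vb b P s := by
  rintro (idx | ((m | m) | ((i | i) | (_ | i))))
  · exact hVb _ idx
  all_goals first
    | (show 0 ≤ (if _ then (0:ℝ) else 1); split_ifs <;> norm_num)
    | (show 0 ≤ (if _ then (1:ℝ) else 0); split_ifs <;> norm_num)
    | (show (0:ℝ) ≤ 1; norm_num)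

theorem sum_ind_mul_notMem (a P : Finset (Fin n)) (x : ℝ) :
    ∑ m, (if m ∈ a then x else 0) * (if m ∈ P then (0:ℝ) else 1) = x * (a \ P).card := by
  classical
  have : ∀ m, (if m ∈ a then x else 0) * (if m ∈ P then (0:ℝ) else 1) = if m ∈ a \ P then x else 0 := by
    intro m
    by_cases ha : m ∈ a <;> by_cases hP : m ∈ P <;> simp [ha, hP, Finset.mem_sdiff]
  simp only [this]
  rw [Finset.sum_ite_mem, Finset.univ_inter, Finset.sum_const, nsmul_eq_mul, mul_comm]

theorem sum_notInd_mul_mem (a P : Finset (Fin n)) (x : ℝ) :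
    ∑ m, (if m ∈ a then 0 else x) * (if m ∈ P then (1:ℝ) else 0) = x * (P \ a).card := by
  classical
  have : ∀ m, (if m ∈ a then 0 else x) * (if m ∈ P then (1:ℝ) else 0) = if m ∈ P \ a then x else 0 := by
    intro m
    by_cases ha : m ∈ a <;> by_cases hP : m ∈ P <;> simp [ha, hP, Finset.mem_sdiff]
  simp only [this]
  rw [Finset.sum_ite_mem, Finset.univ_inter, Finset.sum_const, nsmul_eq_mul, mul_comm]

/-- the tilt part: `Σ_i max(σ_i,0) − Σ_{i∈b} σ_i = Σ_i (σ_i⁺ [i ∉ b] + σ_i⁻ [i ∈ b])`. -/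
theorem tilt_identity (σ : Fin n → ℝ) (b : Finset (Fin n)) :
    ∑ i, max (σ i) 0 - ∑ i ∈ b, σ i =
      ∑ i, max (σ i) 0 * (if i ∈ b then (0:ℝ) else 1) + ∑ i, max (-σ i) 0 * (if i ∈ b then (1:ℝ) else 0) := by
  classical
  have hb : ∑ i ∈ b, σ i = ∑ i, (if i ∈ b then σ i else 0) := by
    rw [Finset.sum_ite_mem, Finset.univ_inter]
  rw [hb, ← Finset.sum_sub_distrib, ← Finset.sum_add_distrib]
  refine Finset.sum_congr rfl fun i _ => ?_
  by_cases hi : i ∈ b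
  · simp only [hi, if_true, mul_zero, mul_one, zero_add]
    rcases le_total 0 (σ i) with h | h
    · rw [max_eq_left h, max_eq_right (by linarith)]; ring
    · rw [max_eq_right h, max_eq_left (by linarith)]; ring
  · simp only [hi, if_false, mul_one, mul_zero, add_zero, sub_zero]

/-- ★★ **THE SLACK IDENTITY**: for every row `(a, σ)` of `diagTilted` and every column `(b, P)`,
`(1 + Σ max(σ_i,0) + n·m_a) − ⟨udRow a + flat(diag σ), udPt b + n•q^c_P⟩ = Σ_s rowF s · colF s`. -/
theorem slack_identity (Ub : Finset (Fin n) → BIdx n → ℝ) (Vb : Finset (Fin n) × Finset (Fin n) → BIdx n → ℝ)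
    (hfacb : ∀ a b P : Finset (Fin n),
      (1 - ((a ∩ b).card : ℝ)) ^ 2 + (a.card : ℝ) * ((n : ℝ) * ((a \ P).card : ℝ) + (n : ℝ) * ((P \ a).card : ℝ)) =
        ∑ idx, Ub a idx * Vb (b, P) idx)
    (a : Finset (Fin n)) (σ : Fin n → ℝ) (b P : Finset (Fin n)) :
    (1 + ∑ i, max (σ i) 0 + (n : ℝ) * mrow n a) - (udRow a + flat (Matrix.diagonal σ)) ⬝ᵥ (udPt b + (n : ℝ) • qCD P) =
      ∑ s, rowF Ub a σ s * colF Vb b P s := by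
  classical
  obtain ⟨-, -, slack, diagPt⟩ := ud_data n
  -- left-hand side = UDISJ + TILT + n·RECOURSE
  have hL : (1 + ∑ i, max (σ i) 0 + (n : ℝ) * mrow n a) -
      (udRow a + flat (Matrix.diagonal σ)) ⬝ᵥ (udPt b + (n : ℝ) • qCD P) =
      (1 - ((a ∩ b).card : ℝ)) ^ 2 + (∑ i, max (σ i) 0 - ∑ i ∈ b, σ i) +
        (n : ℝ) * (mrow n a - udRow a ⬝ᵥ qCD P) := by
    rw [dotProduct_add, add_dotProduct, add_dotProduct, dotProduct_smul, dotProduct_smul,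
      flat_diagonal_dotProduct_qCD, smul_zero, add_zero, smul_eq_mul, diagPt, ← slack a b]
    ring
  rw [hL, tilt_identity, recourse_eq, sum_Slot]
  -- right-hand side, slot by slot
  simp only [rowF, colF]
  by_cases h2 : 2 ≤ a.card
  · have hne : a ≠ ∅ := by rintro rfl; simp at h2
    have hns : ∀ i : Fin n, a ≠ {i} := by
      rintro i rfl; rw [Finset.card_singleton] at h2; omega
    simp only [h2, if_true, hne, hns, if_false, zero_mul, Finset.sum_const_zero, add_zero, mul_one]
    rw [← hfacb a b P, sum_ind_mul_notMem, sum_notInd_mul_mem]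
    unfold c₁ c₂
    ring
  · have hle : a.card ≤ 1 := by omega
    simp only [h2, if_false, zero_mul, Finset.sum_const_zero, add_zero]
    rcases Nat.eq_zero_or_pos a.card with h0 | h1
    · have ha : a = ∅ := Finset.card_eq_zero.1 h0
      subst ha
      have hns : ∀ i : Fin n, ((∅ : Finset (Fin n)) = {i}) = False := fun i =>
        propext ⟨fun h => (Finset.singleton_ne_empty i) h.symm, False.elim⟩
      have hS : ∑ i : Fin n, (if (∅ : Finset (Fin n)) = {i} then (1:ℝ) else 0) * (if i ∈ b then (0:ℝ) else 1) = 0 :=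
        Finset.sum_eq_zero fun i _ => by simp only [hns i, if_false, zero_mul]
      simp only [if_true, hS, add_zero, Finset.empty_inter, Finset.card_empty, Finset.empty_sdiff, Nat.cast_zero, mul_one]
      ring
    · obtain ⟨i₀, ha⟩ := Finset.card_eq_one.1 (le_antisymm hle h1)
      subst ha
      have hne : (({i₀} : Finset (Fin n)) = ∅) = False := propext ⟨Finset.singleton_ne_empty i₀, False.elim⟩
      have hS : ∑ i : Fin n, (if ({i₀} : Finset (Fin n)) = {i} then (1:ℝ) else 0) * (if i ∈ b then (0:ℝ) else 1) =
          (1 - ((({i₀} : Finset (Fin n)) ∩ b).card : ℝ)) ^ 2 := by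
        rw [Finset.sum_eq_single i₀ (fun j _ hj => by
          rw [if_neg (fun h => hj (Finset.singleton_inj.1 h).symm), zero_mul]) (fun h => (h (Finset.mem_univ _)).elim)]
        rw [if_pos rfl, one_mul]
        by_cases hb : i₀ ∈ b
        · rw [if_pos hb, Finset.singleton_inter_of_mem hb, Finset.card_singleton]; norm_num
        · rw [if_neg hb, Finset.singleton_inter_of_notMem hb, Finset.card_empty]; norm_num
      simp only [if_false, zero_mul, zero_add, hne, hS, Finset.card_singleton, Nat.cast_one, sub_self, mul_zero, add_zero]
      ring

/-- `2n² + 8n + 3 ≤ T 2 n` for `n ≥ 2`. -/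
theorem budget_le_T_two' (n : ℕ) (hn : 2 ≤ n) : 2 * n ^ 2 + 8 * n + 3 ≤ T 2 n := by
  have hlt : n < 2 ^ (Nat.log 2 n + 1) := Nat.lt_pow_succ_log_self (by norm_num) n
  have hL1 : 1 ≤ Nat.log 2 n := Nat.le_log_of_pow_le (by norm_num) (by simpa using hn)
  set L := Nat.log 2 n with hL
  have h1 : 2 * n ^ 2 + 8 * n + 3 ≤ 2 * (n + 2) ^ 2 := by nlinarith
  have h2a : n + 2 ≤ 2 ^ (L + 2) := by
    have : 2 ≤ 2 ^ (L + 1) := by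
      calc 2 = 2 ^ 1 := by norm_num
        _ ≤ 2 ^ (L + 1) := Nat.pow_le_pow_right (by norm_num) (by omega)
    have e : 2 ^ (L + 2) = 2 ^ (L + 1) + 2 ^ (L + 1) := by ring
    omega
  have h2 : (n + 2) ^ 2 ≤ (2 ^ (L + 2)) ^ 2 := Nat.pow_le_pow_left h2a 2
  have h3 : 2 * (2 ^ (L + 2)) ^ 2 = 2 ^ (2 * L + 5) := by ring
  have h4 : 2 ^ (2 * L + 5) ≤ 2 ^ ((L + 2) ^ 2) := Nat.pow_le_pow_right (by norm_num) (by nlinarith)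
  have hT : T 2 n = 2 ^ ((L + 2) ^ 2) := rfl
  omega

/-- ★★★ **`diagTilted.Law` (C⁺_diag) IS FALSE.**  At every `n ≥ max n₀ 2` the passenger `n•Q^c` (`K + 1 = 2ⁿ` generators,
`xc ≤ 2n ≤ r := 2n² + 8n + 2`), the row maxima `m(a,σ) = n·m_a` (attained at `P = a`; the tilt is invisible: zero diagonal) and the
explicit nonnegative factorization `rowF`/`colF` through `2n² + 8n + 3 = |Option (Fin r)|` slots satisfy every hypothesis of
`diagTilted.Law` with `c = 2`, while `T 2 n ≥ 2n² + 8n + 3 > r`. -/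
theorem not_diagTiltedLaw : ¬ diagTilted.Law := by
  classical
  intro hL
  obtain ⟨n₀, hn₀⟩ := hL 2
  obtain ⟨n, hnn₀, hn2⟩ : ∃ n, n₀ ≤ n ∧ 2 ≤ n := ⟨max n₀ 2, le_max_left _ _, le_max_right _ _⟩
  -- columns `Fin (K+1) ≃ Finset (Fin n)`
  have hK : Fintype.card (Finset (Fin n)) = (Fintype.card (Finset (Fin n)) - 1) + 1 :=
    (Nat.sub_add_cancel Fintype.card_pos).symm
  set K := Fintype.card (Finset (Fin n)) - 1 with hKdef
  let eC : Finset (Fin n) ≃ Fin (K + 1) := Fintype.equivFinOfCardEq hK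
  let q : Fin (K + 1) → (Fin (n * n) → ℝ) := fun j => (n : ℝ) • qCD (eC.symm j)
  -- slots `Slot n ≃ Option (Fin r)`, `r = 2n² + 8n + 2`
  have hcard : Fintype.card (Slot n) = Fintype.card (Option (Fin (2 * n ^ 2 + 8 * n + 2))) := by
    rw [card_Slot, Fintype.card_option, Fintype.card_fin]
  let eS : Slot n ≃ Option (Fin (2 * n ^ 2 + 8 * n + 2)) := Fintype.equivOfCardEq hcard
  -- the budget
  have hrange : Set.range q = Set.range (fun P : Finset (Fin n) => (n : ℝ) • qCD P) := by
    ext x; constructor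
    · rintro ⟨j, rfl⟩; exact ⟨eC.symm j, rfl⟩
    · rintro ⟨P, rfl⟩; exact ⟨eC P, by simp [q]⟩
  have hQ : HasEFOfSize (convexHull ℝ (Set.range q)) (2 * n ^ 2 + 8 * n + 2) := by
    rw [hrange]; exact (hasEFOfSize_qCD n).of_le (by nlinarith)
  -- the blind identity's factors with `λ₁ = λ₂ = n`
  obtain ⟨Ub, Vb, hUb, hVb, hfacb⟩ := asymBlind_factorization n n n (by omega) (by omega) (by omega)
  have hfacb' : ∀ a b P : Finset (Fin n),
      (1 - ((a ∩ b).card : ℝ)) ^ 2 + (a.card : ℝ) * ((n : ℝ) * ((a \ P).card : ℝ) + (n : ℝ) * ((P \ a).card : ℝ)) =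
        ∑ idx, Ub a idx * Vb (b, P) idx := by
    intro a b P; have h := hfacb a b P; push_cast at h; exact h
  have hcardle : ∀ a : Finset (Fin n), a.card ≤ n := fun a => by
    simpa using Finset.card_le_univ a
  have key := hn₀ n hnn₀ K q (2 * n ^ 2 + 8 * n + 2) hQ (fun a => (n : ℝ) * mrow n a.1)
    (fun a j => by
      show (udRow a.1 + flat (Matrix.diagonal a.2)) ⬝ᵥ ((n : ℝ) • qCD (eC.symm j)) ≤ (n : ℝ) * mrow n a.1
      rw [dotProduct_smul, add_dotProduct, flat_diagonal_dotProduct_qCD, add_zero, smul_eq_mul]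
      have := recourse_nonneg a.1 (eC.symm j) (hcardle a.1)
      nlinarith [Nat.cast_nonneg (α := ℝ) n])
    (fun a => ⟨eC a.1, by
      show (udRow a.1 + flat (Matrix.diagonal a.2)) ⬝ᵥ ((n : ℝ) • qCD (eC.symm (eC a.1))) = (n : ℝ) * mrow n a.1
      rw [Equiv.symm_apply_apply, dotProduct_smul, add_dotProduct, flat_diagonal_dotProduct_qCD, add_zero,
        udRow_dotProduct_qCD_self, smul_eq_mul]⟩)
    (fun a i => rowF Ub a.1 a.2 (eS.symm i)) (fun p i => colF Vb p.1 (eC.symm p.2) (eS.symm i))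
    (fun a i => rowF_nonneg hUb a.1 a.2 (hcardle a.1) _) (fun p i => colF_nonneg Vb hVb _ _ _)
    (fun a b j => by
      show ((1 + ∑ i, max (a.2 i) 0) + (n : ℝ) * mrow n a.1) -
          (udRow a.1 + flat (Matrix.diagonal a.2)) ⬝ᵥ (udPt b + (n : ℝ) • qCD (eC.symm j)) =
        ∑ i, rowF Ub a.1 a.2 (eS.symm i) * colF Vb b (eC.symm j) (eS.symm i)
      rw [slack_identity Ub Vb hfacb' a.1 a.2 b (eC.symm j)]
      exact (Equiv.sum_comp eS.symm (fun s => rowF Ub a.1 a.2 s * colF Vb b (eC.symm j) s)).symm)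
  have hle := budget_le_T_two' n hn2
  omega

end BlindConstDiag

end Summit.ValiantsHypothesis.ValiantsHypothesis.Cruxes.NNDivisionHard.BlindConstDiag41
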